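import Mathlib
import HarnessLib
import Summits.NavierStokesRegularity.NavierStokesRegularity.Theorems.PoloidalWindowRigidity.Negative.TriSheetProfile
import Summits.NavierStokesRegularity.NavierStokesRegularity.Theorems.PoloidalWindowRigidity.Negative.ResidueRev9False

/-!
# Crux `PoloidalWindowRigidity` (K2, stmt-NavierStokesRegularity-19708) — negative side:
# genericity clauses of the residue stub S2⁗ for the three-sheet profile

Negative-side support (refuter seat ns-regularity-refuter1 gen 2, cell ns-regularity-ideate; D-0081 §C), sequel of
`…Negative.TriSheetProfile`.  For the three-sheet profile `v = sheetProfile` (field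
`S = (β(u), β(w) − β(p), −β(u) + β(w) + β(p))`, `u = x₀+x₂`, `w = x₁−x₂`, `p = x₁+x₂`, `β(z) = 2z/(1+z²)⁵`) the
exclusions of S2⁗ hold, by evaluation at rational points of the similarity variable:

* (7) the vorticity direction is constant on no slice (`ω ∥ e₀` at `(1/3)e₀`, `ω ∥ e₁` at `(1/3)e₁`);
* (8) not vertically rigid, (viii) hyperbolic- (not elliptic-) shear-pinched, (9) `v·e₂` flat in no horizontal
  direction, (iv) super-critical horizontal strain `(−s)⟪Dv e₀, e₀⟫ = 2` — all at the similarity origin;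
* the ZERO SET of `S` is the origin (`sheetField_eq_zero_iff`), whence: (12) not scale-invariant (`log 4 ≠ 0`),
  (10) no translation invariance on any slice, (v′)/(15) no common (vertical) period, (13) no vertical screw
  symmetry (the full turn is a vertical translation by `2π/κ ≠ 0`), and (vi′) no discrete spiral parabolic
  self-similarity about any centre `c`: the similarity origin is carried to `R_{κr}(−c) + e^{−r}c + 2r e₁`, which
  must vanish for every `r`; the norms at `r = ±1` give `4e² + 4 = 0`.

WHAT THIS IS NOT: not a claim about Navier–Stokes — kinematics of an explicit profile; the crux K2 stays open.
[folklore]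
-/

noncomputable section

-- the summit and its single sub-problem share the name (CONVENTIONS §1), as in every Theorems file
set_option linter.dupNamespace false

namespace Summit.NavierStokesRegularity.NavierStokesRegularity.Theorems.PoloidalWindowRigidity.Negative

open MeasureTheory Set Function Filter Topology Metric
open scoped RealInnerProductSpace InnerProductSpace ENNReal NNReal
open Literature.Analysis Literature.Analysis.FluidPDE

/-! ## Point evaluations -/

/-- A point with prescribed similarity variable: `A_s (c_s^{-1}(X − log(−s)e₁)) = X`. [folklore] -/
theorem sheetProfile_at_invPoint {s : ℝ} (hs : s < 0) (X : EuclideanSpace ℝ (Fin 3)) :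
    sheetProfile s ((cellAmp s)⁻¹ • (X - Real.log (-s) • (EuclideanSpace.single (1 : Fin 3) (1 : ℝ)))) =
      cellAmp s • sheetField X := by
  rw [sheetProfile, driftShift_invPoint hs]

/-- (7) vorticity direction constant on no slice: for `b ≠ 0` some `curl v(s)(x) × b ≠ 0` (at the `A_s`-preimages of
`(1/3)e₀` and `(1/3)e₁` the vorticity is `8(−s)^{-1} e₀` and `4(−s)^{-1} e₁`, as `β′(1/3) = 0`). [folklore] -/
theorem vorticityDirection_nonconstant_sheetProfile {s : ℝ} (hs : s < 0) (b : EuclideanSpace ℝ (Fin 3))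
    (hb : b ≠ 0) : ∃ x : EuclideanSpace ℝ (Fin 3), cross (curl (sheetProfile s) x) b ≠ 0 := by
  by_contra hcon
  simp only [not_exists, ne_eq, not_not] at hcon
  have hamp := (cellAmp_pos hs).ne'
  have hc2 : cellAmp s ^ 2 ≠ 0 := pow_ne_zero 2 hamp
  have key : ∀ X : EuclideanSpace ℝ (Fin 3),
      cross ((cellAmp s ^ 2 * (2 * oddBumpDeriv (X 1 - X 2) + 2 * oddBumpDeriv (X 1 + X 2))) •
          (EuclideanSpace.single (0 : Fin 3) (1 : ℝ)) +
        (cellAmp s ^ 2 * (2 * oddBumpDeriv (X 0 + X 2))) • (EuclideanSpace.single (1 : Fin 3) (1 : ℝ))) b = 0 := by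
    intro X
    have h := hcon ((cellAmp s)⁻¹ • (X - Real.log (-s) • (EuclideanSpace.single (1 : Fin 3) (1 : ℝ))))
    rwa [curl_sheetProfile, driftShift_invPoint hs] at h
  have h1 := key ((1 / 3 : ℝ) • (EuclideanSpace.single (0 : Fin 3) (1 : ℝ)))
  have h2 := key ((1 / 3 : ℝ) • (EuclideanSpace.single (1 : Fin 3) (1 : ℝ)))
  have p0 : ((1 / 3 : ℝ) • (EuclideanSpace.single (0 : Fin 3) (1 : ℝ)) : EuclideanSpace ℝ (Fin 3)) 0 = 1 / 3 := by
    simp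
  have p1 : ((1 / 3 : ℝ) • (EuclideanSpace.single (0 : Fin 3) (1 : ℝ)) : EuclideanSpace ℝ (Fin 3)) 1 = 0 := by simp
  have p2 : ((1 / 3 : ℝ) • (EuclideanSpace.single (0 : Fin 3) (1 : ℝ)) : EuclideanSpace ℝ (Fin 3)) 2 = 0 := by simp
  have q0 : ((1 / 3 : ℝ) • (EuclideanSpace.single (1 : Fin 3) (1 : ℝ)) : EuclideanSpace ℝ (Fin 3)) 0 = 0 := by simp
  have q1 : ((1 / 3 : ℝ) • (EuclideanSpace.single (1 : Fin 3) (1 : ℝ)) : EuclideanSpace ℝ (Fin 3)) 1 = 1 / 3 := by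
    simp
  have q2 : ((1 / 3 : ℝ) • (EuclideanSpace.single (1 : Fin 3) (1 : ℝ)) : EuclideanSpace ℝ (Fin 3)) 2 = 0 := by simp
  simp only [p0, p1, p2, q0, q1, q2, add_zero, sub_zero, oddBumpDeriv_zero, oddBumpDeriv_third] at h1 h2
  norm_num at h1 h2
  have h1c := congrArg (fun w : EuclideanSpace ℝ (Fin 3) => w 2) h1
  have h2a := congrArg (fun w : EuclideanSpace ℝ (Fin 3) => w 0) h2
  have h2c := congrArg (fun w : EuclideanSpace ℝ (Fin 3) => w 2) h2
  simp [cross, cross_apply, hamp] at h1c h2a h2c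
  apply hb
  ext i
  fin_cases i
  · simpa using h2c
  · simpa using h1c
  · simpa using h2a

/-- (8) not vertically rigid on any slice: `(Dv(s) e₂)₀ = 2(−s)^{-1}` at the `A_s`-preimage of the origin.
[folklore] -/
theorem not_vertRigid_sheetProfile {s : ℝ} (hs : s < 0) :
    ∃ x : EuclideanSpace ℝ (Fin 3), fderiv ℝ (sheetProfile s) x (EuclideanSpace.single (2 : Fin 3) (1 : ℝ)) 0 ≠ 0 := by
  refine ⟨(cellAmp s)⁻¹ • ((0 : EuclideanSpace ℝ (Fin 3)) - Real.log (-s) •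
      (EuclideanSpace.single (1 : Fin 3) (1 : ℝ))), ?_⟩
  rw [fderiv_sheetProfile_apply, driftShift_invPoint hs, sheetDeriv_apply_zero]
  simp [(cellAmp_pos hs).ne', oddBumpDeriv_zero]

/-- (viii) [rev 11] no slice is elliptic-shear-pinched: the field is HYPERBOLIC-shear-pinched, `∂₂S_h = −∇_h S₂`
(`S_h = ∇_h φ`, `S₂ = −∂₂φ`); at the similarity origin `∂₂v₀ = 2c_s² > 0 > −2m c_s² = m ∂₀v₂` for every `m > 0`, so the
first alternative of clause (viii) holds for all `m ∈ [μ₀, μ₁]`, `μ₀ > 0`. [folklore] -/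
theorem not_ellipticShearPinched_sheetProfile {s : ℝ} (hs : s < 0) (μ₀ μ₁ : ℝ) (hμ₀ : 0 < μ₀) :
    ∃ y : EuclideanSpace ℝ (Fin 3), ∀ m : ℝ, μ₀ ≤ m → m ≤ μ₁ →
      fderiv ℝ (sheetProfile s) y (EuclideanSpace.single 2 1) 0 ≠
          m * fderiv ℝ (sheetProfile s) y (EuclideanSpace.single 0 1) 2 ∨
        fderiv ℝ (sheetProfile s) y (EuclideanSpace.single 2 1) 1 ≠
          m * fderiv ℝ (sheetProfile s) y (EuclideanSpace.single 1 1) 2 := by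
  refine ⟨(cellAmp s)⁻¹ • ((0 : EuclideanSpace ℝ (Fin 3)) - Real.log (-s) •
      (EuclideanSpace.single (1 : Fin 3) (1 : ℝ))), fun m hm _ => Or.inl ?_⟩
  intro h
  rw [fderiv_sheetProfile_apply, fderiv_sheetProfile_apply, driftShift_invPoint hs, sheetDeriv_apply_zero,
    sheetDeriv_apply_two] at h
  have e20 : (EuclideanSpace.single (2 : Fin 3) (1 : ℝ) : EuclideanSpace ℝ (Fin 3)) 0 = 0 := by simp
  have e22 : (EuclideanSpace.single (2 : Fin 3) (1 : ℝ) : EuclideanSpace ℝ (Fin 3)) 2 = 1 := by simp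
  have e00 : (EuclideanSpace.single (0 : Fin 3) (1 : ℝ) : EuclideanSpace ℝ (Fin 3)) 0 = 1 := by simp
  have e01 : (EuclideanSpace.single (0 : Fin 3) (1 : ℝ) : EuclideanSpace ℝ (Fin 3)) 1 = 0 := by simp
  have e02 : (EuclideanSpace.single (0 : Fin 3) (1 : ℝ) : EuclideanSpace ℝ (Fin 3)) 2 = 0 := by simp
  simp only [PiLp.zero_apply, e20, e22, e00, e01, e02, add_zero, sub_zero, zero_add, oddBumpDeriv_zero,
    mul_zero, mul_one] at h
  have hc : 0 < cellAmp s ^ 2 := pow_pos (cellAmp_pos hs) 2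
  have hm0 : 0 < m := hμ₀.trans_le hm
  nlinarith [mul_pos hm0 hc]

/-- (9) `v·e₂` is flat in no horizontal direction: `⟪Dv(s) a, e₂⟫ = (−s)^{-1}(−β′(u)a₀ + (β′(w)+β′(p))a₁)` is
`−2(−s)^{-1}a₀` at `(1/3)e₁` and `4(−s)^{-1}a₁` at `(1/3)e₀`. [folklore] -/
theorem flat_in_no_horizontal_direction_sheetProfile {s : ℝ} (hs : s < 0) (a : EuclideanSpace ℝ (Fin 3))
    (ha : a ≠ 0) (ha2 : ⟪a, (EuclideanSpace.single (2 : Fin 3) (1 : ℝ))⟫_ℝ = 0) :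
    ∃ x : EuclideanSpace ℝ (Fin 3),
      ⟪fderiv ℝ (sheetProfile s) x a, (EuclideanSpace.single (2 : Fin 3) (1 : ℝ))⟫_ℝ ≠ 0 := by
  have hc := (cellAmp_pos hs).ne'
  have ha2' : a 2 = 0 := by simpa [EuclideanSpace.inner_single_right] using ha2
  by_cases h0 : a 0 = 0
  · have h1 : a 1 ≠ 0 := by
      intro h1
      apply ha
      ext i
      fin_cases i
      · exact h0
      · exact h1
      · exact ha2'
    refine ⟨(cellAmp s)⁻¹ • (((1 / 3 : ℝ) • (EuclideanSpace.single (0 : Fin 3) (1 : ℝ))) - Real.log (-s) •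
      (EuclideanSpace.single (1 : Fin 3) (1 : ℝ))), ?_⟩
    rw [EuclideanSpace.inner_single_right, fderiv_sheetProfile_apply, driftShift_invPoint hs, sheetDeriv_apply_two]
    have p0 : ((1 / 3 : ℝ) • (EuclideanSpace.single (0 : Fin 3) (1 : ℝ)) : EuclideanSpace ℝ (Fin 3)) 0 = 1 / 3 := by
      simp
    have p1 : ((1 / 3 : ℝ) • (EuclideanSpace.single (0 : Fin 3) (1 : ℝ)) : EuclideanSpace ℝ (Fin 3)) 1 = 0 := by simp
    have p2 : ((1 / 3 : ℝ) • (EuclideanSpace.single (0 : Fin 3) (1 : ℝ)) : EuclideanSpace ℝ (Fin 3)) 2 = 0 := by simp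
    simp only [p0, p1, p2, ha2', h0, add_zero, sub_zero, oddBumpDeriv_zero, oddBumpDeriv_third]
    norm_num
    exact ⟨hc, h1⟩
  · refine ⟨(cellAmp s)⁻¹ • (((1 / 3 : ℝ) • (EuclideanSpace.single (1 : Fin 3) (1 : ℝ))) - Real.log (-s) •
      (EuclideanSpace.single (1 : Fin 3) (1 : ℝ))), ?_⟩
    rw [EuclideanSpace.inner_single_right, fderiv_sheetProfile_apply, driftShift_invPoint hs, sheetDeriv_apply_two]
    have p0 : ((1 / 3 : ℝ) • (EuclideanSpace.single (1 : Fin 3) (1 : ℝ)) : EuclideanSpace ℝ (Fin 3)) 0 = 0 := by simp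
    have p1 : ((1 / 3 : ℝ) • (EuclideanSpace.single (1 : Fin 3) (1 : ℝ)) : EuclideanSpace ℝ (Fin 3)) 1 = 1 / 3 := by
      simp
    have p2 : ((1 / 3 : ℝ) • (EuclideanSpace.single (1 : Fin 3) (1 : ℝ)) : EuclideanSpace ℝ (Fin 3)) 2 = 0 := by simp
    simp only [p0, p1, p2, ha2', add_zero, sub_zero, oddBumpDeriv_zero, oddBumpDeriv_third]
    norm_num
    exact ⟨hc, h0⟩

/-- (iv) super-critical horizontal strain somewhere: at `(−1, 0)` with `a = e₀`, `(−s)⟪Dv a, a⟫ = β′(0) = 2 > Λ‖a‖²`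
for every `Λ < 1` (indeed `< 2`). [folklore] -/
theorem sheetProfile_supercritical_strain (Λ : ℝ) (hΛ : Λ < 1) :
    ∃ s < 0, ∃ (y a : EuclideanSpace ℝ (Fin 3)), ⟪a, (EuclideanSpace.single (2 : Fin 3) (1 : ℝ))⟫_ℝ = 0 ∧
      Λ * ‖a‖ ^ 2 < (-s) * ⟪fderiv ℝ (sheetProfile s) y a, a⟫_ℝ := by
  refine ⟨-1, by norm_num, 0, (EuclideanSpace.single (0 : Fin 3) (1 : ℝ)), ?_, ?_⟩
  · rw [EuclideanSpace.inner_single_left]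
    simp
  rw [sheetProfile_neg_one, fderiv_sheetField, EuclideanSpace.inner_single_right, sheetDeriv_apply_zero]
  have e00 : (EuclideanSpace.single (0 : Fin 3) (1 : ℝ) : EuclideanSpace ℝ (Fin 3)) 0 = 1 := by simp
  have e02 : (EuclideanSpace.single (0 : Fin 3) (1 : ℝ) : EuclideanSpace ℝ (Fin 3)) 2 = 0 := by simp
  have hn : ‖(EuclideanSpace.single (0 : Fin 3) (1 : ℝ) : EuclideanSpace ℝ (Fin 3))‖ = 1 := by simp
  simp only [PiLp.zero_apply, e00, e02, hn, add_zero, oddBumpDeriv_zero]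
  norm_num
  linarith

/-! ## The zero set of the three-sheet field is the origin -/

/-- `β(z) = 0 ↔ z = 0`. [folklore] -/
theorem oddBump_eq_zero_iff {z : ℝ} : oddBump z = 0 ↔ z = 0 := by
  unfold oddBump
  rw [div_eq_zero_iff]
  have hp : (1 + z ^ 2) ^ 5 ≠ 0 := pow_ne_zero 5 (show (0:ℝ) < 1 + z ^ 2 by positivity).ne'
  constructor
  · rintro (h | h)
    · linarith
    · exact absurd h hp
  · intro h
    left
    rw [h, mul_zero]

/-- `S(0) = 0`. [folklore] -/
theorem sheetField_zero : sheetField 0 = 0 := by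
  ext i
  fin_cases i <;> simp [sheetField_apply_zero, sheetField_apply_one, sheetField_apply_two, oddBump_zero]

/-- **The zero set of `S` is the origin**: `β(u) = 0`, `β(w) = β(p)`, `β(w) + β(p) = β(u)` force
`u = w = p = 0`. [folklore] -/
theorem sheetField_eq_zero_iff {x : EuclideanSpace ℝ (Fin 3)} : sheetField x = 0 ↔ x = 0 := by
  constructor
  · intro h
    have h0 := congrArg (fun w : EuclideanSpace ℝ (Fin 3) => w 0) h
    have h1 := congrArg (fun w : EuclideanSpace ℝ (Fin 3) => w 1) h
    have h2 := congrArg (fun w : EuclideanSpace ℝ (Fin 3) => w 2) h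
    simp only [sheetField_apply_zero, sheetField_apply_one, sheetField_apply_two, PiLp.zero_apply] at h0 h1 h2
    have hu : x 0 + x 2 = 0 := oddBump_eq_zero_iff.1 h0
    have hw : x 1 - x 2 = 0 := oddBump_eq_zero_iff.1 (by linarith)
    have hp : x 1 + x 2 = 0 := oddBump_eq_zero_iff.1 (by linarith)
    ext i
    fin_cases i
    · show x 0 = 0
      linarith
    · show x 1 = 0
      linarith
    · show x 2 = 0
      linarith
  · intro h
    rw [h, sheetField_zero]

/-- (12) not scale-invariant: `2 v(−4, 0) = S(log 4 · e₁) ≠ 0 = v(−1, 0)` as `log 4 ≠ 0`. [folklore] -/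
theorem not_scaleInvariant_sheetProfile :
    (2 : ℝ) • sheetProfile ((2 : ℝ) ^ 2 * (-1)) ((2 : ℝ) • (0 : EuclideanSpace ℝ (Fin 3))) ≠ sheetProfile (-1) 0 := by
  intro h
  rw [sheetProfile_neg_one, sheetField_zero, smul_zero, sheetProfile, smul_eq_zero, smul_eq_zero,
    sheetField_eq_zero_iff] at h
  have h4 : (2 : ℝ) ^ 2 * (-1) = -4 := by norm_num
  rcases h with h | h | h
  · norm_num at h
  · rw [h4] at h
    exact (cellAmp_pos (by norm_num : (-4 : ℝ) < 0)).ne' h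
  · have h1 := congrArg (fun w : EuclideanSpace ℝ (Fin 3) => w 1) h
    rw [driftShift_apply_one, h4] at h1
    simp only [PiLp.zero_apply, mul_zero, zero_add, neg_neg] at h1
    exact Real.log_ne_zero_of_pos_of_ne_one (by norm_num) (by norm_num) h1

/-- (10) invariant under no spatial translation on any slice: the shift by `c_s^{-1} e` from the `A_s`-preimage
of the origin reads `S(e) = S(0) = 0`. [folklore] -/
theorem not_translationInvariant_sheetProfile {s : ℝ} (hs : s < 0) (e : EuclideanSpace ℝ (Fin 3)) (he : e ≠ 0) :
    ∃ (x : EuclideanSpace ℝ (Fin 3)) (l : ℝ), sheetProfile s (x + l • e) ≠ sheetProfile s x := by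
  by_contra hcon
  push Not at hcon
  have hc := (cellAmp_pos hs).ne'
  have h := hcon ((cellAmp s)⁻¹ • ((0 : EuclideanSpace ℝ (Fin 3)) - Real.log (-s) •
    (EuclideanSpace.single (1 : Fin 3) (1 : ℝ)))) (cellAmp s)⁻¹
  unfold sheetProfile at h
  rw [driftShift_add_smul, driftShift_invPoint hs, zero_add, mul_inv_cancel₀ hc, one_smul, sheetField_zero] at h
  exact he (sheetField_eq_zero_iff.1 (smul_right_injective _ hc h))

/-- (v′) no common spatial period: `ℓ ≠ 0` moves the slice `s = −1` at the origin. [folklore] -/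
theorem sheetProfile_no_common_period (ℓ : EuclideanSpace ℝ (Fin 3)) (hℓ : ℓ ≠ 0) :
    ∃ s < 0, ∃ y : EuclideanSpace ℝ (Fin 3), sheetProfile s (y + ℓ) ≠ sheetProfile s y := by
  refine ⟨-1, by norm_num, 0, ?_⟩
  rw [sheetProfile_neg_one, zero_add, sheetField_zero]
  exact fun h => hℓ (sheetField_eq_zero_iff.1 h)

/-- (15) no common vertical period. [folklore] -/
theorem sheetProfile_no_vertical_period (L : ℝ) (hL : 0 < L) :
    ∃ s < 0, ∃ y : EuclideanSpace ℝ (Fin 3),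
      sheetProfile s (y + L • (EuclideanSpace.single (2 : Fin 3) (1 : ℝ))) ≠ sheetProfile s y := by
  refine sheetProfile_no_common_period (L • (EuclideanSpace.single (2 : Fin 3) (1 : ℝ))) ?_
  intro h
  have := congrArg (fun w : EuclideanSpace ℝ (Fin 3) => w 2) h
  simp [hL.ne'] at this

/-- (13) invariant under no vertical screw motion with pitch `κ ≠ 0` about any vertical axis: the full turn
`a = 2π/κ` at `y = 0` on the slice `s = −1` reads `S((2π/κ) e₂) = S(0) = 0`. [folklore] -/
theorem not_screwInvariant_sheetProfile (κ : ℝ) (hκ : κ ≠ 0) (c : EuclideanSpace ℝ (Fin 3)) :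
    ∃ s < 0, ∃ (a : ℝ) (y : EuclideanSpace ℝ (Fin 3)),
      sheetProfile s (c + rotZ (κ * a) (y - c) + a • (EuclideanSpace.single (2 : Fin 3) (1 : ℝ))) ≠
        rotZ (κ * a) (sheetProfile s y) := by
  refine ⟨-1, by norm_num, 2 * Real.pi / κ, 0, ?_⟩
  have hk1 : κ * (2 * Real.pi / κ) = 2 * Real.pi := by field_simp
  rw [hk1, rotZ_eq_self_of_cos_eq_one Real.cos_two_pi Real.sin_two_pi,
    rotZ_eq_self_of_cos_eq_one Real.cos_two_pi Real.sin_two_pi, zero_sub, add_neg_cancel, zero_add,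
    sheetProfile_neg_one, sheetField_zero]
  intro h
  have h2 := congrArg (fun w : EuclideanSpace ℝ (Fin 3) => w 2) (sheetField_eq_zero_iff.1 h)
  simp [hκ, Real.pi_pos.ne'] at h2

/-! ## (vi′) no discrete spiral self-similarity -/

/-- The amplitude of the slice `s = −e^{2r}`: `(e^{2r})^{-1/2} = (e^r)^{-1}`. [folklore] -/
theorem cellAmp_exp_sq_mul_neg_one (r : ℝ) : cellAmp (Real.exp r ^ 2 * (-1)) = (Real.exp r)⁻¹ := by
  rw [cellAmp, show -(Real.exp r ^ 2 * (-1)) = Real.exp r ^ 2 by ring, Real.sqrt_sq (Real.exp_pos r).le]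

/-- The drift of the slice `s = −e^{2r}`: `log(e^{2r}) = 2r`. [folklore] -/
theorem log_exp_sq_mul_neg_one (r : ℝ) : Real.log (-(Real.exp r ^ 2 * (-1))) = 2 * r := by
  rw [show -(Real.exp r ^ 2 * (-1)) = Real.exp r ^ 2 by ring, Real.log_pow, Real.log_exp]
  push_cast
  ring

/-- Under the spiral similarity `(r, s, y) = (r, −1, −c)` the similarity origin is carried to
`R_{κr}(−c) + e^{−r} c + 2r e₁`, where `S` must vanish. [folklore] -/
theorem spiral_origin_eq_zero {c : EuclideanSpace ℝ (Fin 3)} {κ : ℝ}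
    (H : ∀ r : ℝ, ∀ s < 0, ∀ y : EuclideanSpace ℝ (Fin 3),
      Real.exp r • sheetProfile (Real.exp r ^ 2 * s) (Real.exp r • rotZ (κ * r) y + c) =
        rotZ (κ * r) (sheetProfile s (y + c))) (r : ℝ) :
    rotZ (κ * r) (-c) + (Real.exp r)⁻¹ • c + (2 * r) • (EuclideanSpace.single (1 : Fin 3) (1 : ℝ)) = 0 := by
  have h := H r (-1) (by norm_num) (-c)
  have hR0 : rotZ (κ * r) (0 : EuclideanSpace ℝ (Fin 3)) = 0 := by
    ext i
    fin_cases i <;> simp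
  rw [neg_add_cancel, sheetProfile_neg_one, sheetField_zero, hR0, sheetProfile, smul_smul,
    cellAmp_exp_sq_mul_neg_one, mul_inv_cancel₀ (Real.exp_pos r).ne', one_smul, driftShift,
    cellAmp_exp_sq_mul_neg_one, log_exp_sq_mul_neg_one, sheetField_eq_zero_iff, smul_add, smul_smul,
    inv_mul_cancel₀ (Real.exp_pos r).ne', one_smul] at h
  exact h

/-- **(vi′) no discrete (spiral) parabolic self-similarity** about any centre `c` with any angular velocity `κ`:
`R_{κr} c = e^{−r}c + 2r e₁` for `r = 1` and `r = −1`, and the norms give `‖c‖² = e^{∓2}‖c‖² ± 4e^{∓1}c₁ + 4`,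
whose combination is `4e² + 4 = 0`. [folklore] -/
theorem not_spiralSelfSimilar_sheetProfile (c : EuclideanSpace ℝ (Fin 3)) (κ : ℝ) :
    ∃ r : ℝ, ∃ s < 0, ∃ y : EuclideanSpace ℝ (Fin 3),
      Real.exp r • sheetProfile (Real.exp r ^ 2 * s) (Real.exp r • rotZ (κ * r) y + c) ≠
        rotZ (κ * r) (sheetProfile s (y + c)) := by
  by_contra H
  push Not at H
  set p : ℝ := Real.exp 1 with hp
  have hppos : 0 < p := Real.exp_pos 1
  have hq : Real.exp (-1) = p⁻¹ := by rw [hp, Real.exp_neg]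
  -- `r = 1`:  `R c = p⁻¹ c + 2 e₁`, so `p R c = c + 2p e₁`
  have h1 := spiral_origin_eq_zero H 1
  -- `r = −1`: `R' c = p c − 2 e₁`
  have h2 := spiral_origin_eq_zero H (-1)
  rw [hq, inv_inv] at h2
  have n1 : ‖p • rotZ (κ * 1) c‖ ^ 2 = ‖c + (2 * p) • (EuclideanSpace.single (1 : Fin 3) (1 : ℝ))‖ ^ 2 := by
    congr 2
    have e : p • rotZ (κ * 1) c = p • ((Real.exp 1)⁻¹ • c + (2 * (1 : ℝ)) • (EuclideanSpace.single (1 : Fin 3)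
        (1 : ℝ))) := by
      congr 1
      have hneg : rotZ (κ * 1) (-c) = -rotZ (κ * 1) c := by
        ext i
        fin_cases i <;> simp <;> ring
      rw [hneg, add_assoc, neg_add_eq_zero] at h1
      exact h1
    rw [e, smul_add, smul_smul, smul_smul, ← hp, mul_inv_cancel₀ hppos.ne', one_smul, mul_one, mul_comm p 2]
  have n2 : ‖rotZ (κ * (-1)) c‖ ^ 2 = ‖p • c + (-2 : ℝ) • (EuclideanSpace.single (1 : Fin 3) (1 : ℝ))‖ ^ 2 := by
    congr 2
    have hneg : rotZ (κ * (-1)) (-c) = -rotZ (κ * (-1)) c := by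
      ext i
      fin_cases i <;> simp <;> ring
    rw [hneg, add_assoc, neg_add_eq_zero] at h2
    rw [h2]
    norm_num
  rw [norm_smul, Real.norm_of_nonneg hppos.le, norm_rotZ, mul_pow,
    Literature.Algebra.EuclideanLattices.norm_sq_fin_three c,
    Literature.Algebra.EuclideanLattices.norm_sq_fin_three] at n1
  rw [norm_rotZ, Literature.Algebra.EuclideanLattices.norm_sq_fin_three c,
    Literature.Algebra.EuclideanLattices.norm_sq_fin_three] at n2
  simp at n1 n2
  nlinarith [sq_nonneg p, sq_nonneg (c 0), sq_nonneg (c 2), hppos]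

end Summit.NavierStokesRegularity.NavierStokesRegularity.Theorems.PoloidalWindowRigidity.Negative

end
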